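import Mathlib.Order.Zorn
import Mathlib.Data.Set.Card
import Literature.AnabelianGeometry.SemiGraphs.TemperedCompactPreimage
import Literature.AnabelianGeometry.SemiGraphs.TemperedQuasiGeometric
import HarnessLib

/-!
# Maximal compact subgroups of a tempered group exist (Zorn), when the discrete quotients have bounded finite subgroups

Mochizuki, *Semi-graphs of anabelioids*, Publ. RIMS **42** (2006), §3: Def. 3.1 (i) (tempered groups,
`Π = lim_N Π/N` over countable discrete quotients, p. 33) and Thm. 3.7 (iv) / Def. 3.8 (the MAXIMAL COMPACT
SUBGROUPS of `π₁^temp(𝒢)`, pp. 41–42) [cite: MochizukiSemiAnbd2006, Def 3.1(i) p.33]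
[cite: MochizukiSemiAnbd2006, Thm 3.7(iv) p.41].

PROOF-ONLY file (abc-iut cell, layer L3 frontier programme «REFUTE-F1732», support lemma in BINDER form for
the assembly brick R7 / abc-iut-L3-d1's addendum (ε): «every compact subgroup lies in SOME maximal compact
subgroup»; seat abc-iut-w6-d120; no definition, no new named fact).  Pure topological group theory over the
tree's `IsTempered` (`TemperedGroups.lean`), `IsMaximalCompactSubgroup` (`TemperedQuasiGeometric.lean`) and the
compactness criterion `IsTempered.isCompact_of_finite_image` (`TemperedCompactPreimage.lean`):

* `IsTempered.image_mk_finite_of_isCompact` — a compact subgroup has FINITE image in every discrete quotient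
  `Π/N`, `N` open normal;
* `IsTempered.isCompact_closure_sUnion_of_isChain` — if along a COFINAL family of open normal subgroups `N`
  the finite subgroups of `Π/N` have BOUNDED order (binder `hbd`; e.g. every Bass–Serre level group of a graph
  of finite groups with bounded vertex orders: a finite subgroup fixes a vertex), then the closure of the
  union of a nonempty chain of compact subgroups is compact (its image in each such `Π/N` is a bounded
  increasing union of finite subgroups, hence one of them);
* `IsTempered.exists_isMaximalCompactSubgroup_ge` — hence, by Zorn's lemma, every compact subgroup `C` is
  contained in a maximal compact subgroup; `IsTempered.exists_isMaximalCompactSubgroup` (`C = ⊥`).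

At a FINITE semi-graph this is a consequence of Thm 3.7 (iii)/(iv) (`TemperedMaximalCompactFiniteAt.lean`);
the present form needs no graph and serves infinite `𝔾` (where Thm 3.7 (iii) is not available).
HONEST FRAMING: nothing here bears on [IUTchIII] Cor. 3.12; no side taken; typed ≠ proved elsewhere.
-/

namespace Literature.AnabelianGeometry.SemiGraphs

open Topology
open scoped Pointwise

universe u

variable {T : Type u} [Group T] [TopologicalSpace T] [IsTopologicalGroup T]

/-! ### Compact subgroups have finite images in the discrete quotients -/

/-- The image of a compact set in the discrete quotient `Π/N` (`N` an open normal subgroup) is finite.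
[cite: MochizukiSemiAnbd2006, Def 3.1(i) p.33] -/
theorem IsTempered.image_mk_finite_of_isCompact (N : OpenNormalSubgroup T) {S : Set T}
    (hS : IsCompact S) : ((QuotientGroup.mk : T → T ⧸ N.toSubgroup) '' S).Finite := by
  haveI : DiscreteTopology (T ⧸ N.toSubgroup) := QuotientGroup.discreteTopology N.isOpen
  exact (hS.image (QuotientGroup.continuous_mk (N := N.toSubgroup))).finite_of_discrete

omit [IsTopologicalGroup T] in
/-- The image of a subgroup in `Π/N`, as a subgroup, has underlying set the image set. [folklore] -/
private theorem IsTempered.coe_map_mk_eq_image (N : OpenNormalSubgroup T) (K : Subgroup T) :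
    ((K.map (QuotientGroup.mk' N.toSubgroup) : Subgroup (T ⧸ N.toSubgroup)) : Set (T ⧸ N.toSubgroup)) =
      (QuotientGroup.mk : T → T ⧸ N.toSubgroup) '' (K : Set T) := by
  ext x
  simp

/-! ### Chains of compact subgroups: the closure of the union is compact -/

/-- **Bounded increasing unions of finite subgroups stabilise.**  If the finite subgroups of `Π/N` have order
`≤ B`, then for a nonempty chain `c` of compact subgroups of `Π` there is ONE member `K₀ ∈ c` whose image in
`Π/N` contains the image of every member (the finite-level step towards the maximal compact subgroups
of [SemiAnbd] Thm 3.7 (iv)). [cite: MochizukiSemiAnbd2006, Thm 3.7(iv) p.41] -/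
theorem IsTempered.exists_image_subset_of_isChain (N : OpenNormalSubgroup T) {B : ℕ}
    (hB : ∀ H : Subgroup (T ⧸ N.toSubgroup), (H : Set (T ⧸ N.toSubgroup)).Finite → Nat.card H ≤ B)
    {c : Set (Subgroup T)} (hc : IsChain (· ≤ ·) c) (hne : c.Nonempty)
    (hcpt : ∀ K ∈ c, IsCompact (K : Set T)) :
    ∃ K₀ ∈ c, ∀ K ∈ c, (QuotientGroup.mk : T → T ⧸ N.toSubgroup) '' (K : Set T) ⊆
      (QuotientGroup.mk : T → T ⧸ N.toSubgroup) '' (K₀ : Set T) := by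
  classical
  -- the image cardinalities form a bounded set of naturals; pick a member realising the maximum
  let f : Subgroup T → ℕ := fun K => ((QuotientGroup.mk : T → T ⧸ N.toSubgroup) '' (K : Set T)).ncard
  have hfin : ∀ K ∈ c, ((QuotientGroup.mk : T → T ⧸ N.toSubgroup) '' (K : Set T)).Finite :=
    fun K hK => IsTempered.image_mk_finite_of_isCompact N (hcpt K hK)
  have hfB : ∀ K ∈ c, f K ≤ B := by
    intro K hK
    have h := hB (K.map (QuotientGroup.mk' N.toSubgroup))
      (by rw [IsTempered.coe_map_mk_eq_image]; exact hfin K hK)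
    have hcard : Nat.card (K.map (QuotientGroup.mk' N.toSubgroup)) = f K := by
      change Nat.card ((K.map (QuotientGroup.mk' N.toSubgroup) : Set (T ⧸ N.toSubgroup))) = _
      rw [IsTempered.coe_map_mk_eq_image, Nat.card_coe_set_eq]
    rw [← hcard]
    exact h
  -- maximum of `f` on `c`
  obtain ⟨K₁, hK₁⟩ := hne
  have hex : ∃ m, (∃ K ∈ c, f K = m) ∧ ∀ K ∈ c, f K ≤ m := by
    -- take the largest value `m ≤ B` attained on `c`
    let P : ℕ → Prop := fun m => ∃ K ∈ c, f K = m
    have hPB : ∀ m, P m → m ≤ B := fun m ⟨K, hK, hm⟩ => hm ▸ hfB K hK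
    let m := Nat.findGreatest P B
    have hPm : P m := Nat.findGreatest_spec (P := P) (hfB K₁ hK₁) ⟨K₁, hK₁, rfl⟩
    refine ⟨m, hPm, fun K hK => ?_⟩
    exact Nat.le_findGreatest (hfB K hK) ⟨K, hK, rfl⟩
  obtain ⟨m, ⟨K₀, hK₀, hfK₀⟩, hmax⟩ := hex
  refine ⟨K₀, hK₀, fun K hK => ?_⟩
  rcases hc.total hK hK₀ with hle | hle
  · exact Set.image_mono hle
  · -- `K₀ ≤ K`: the images are nested finite sets with `card (im K) ≤ card (im K₀)`, hence equal
    have hsub : (QuotientGroup.mk : T → T ⧸ N.toSubgroup) '' (K₀ : Set T) ⊆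
        (QuotientGroup.mk : T → T ⧸ N.toSubgroup) '' (K : Set T) := Set.image_mono hle
    have hcard : ((QuotientGroup.mk : T → T ⧸ N.toSubgroup) '' (K : Set T)).ncard ≤
        ((QuotientGroup.mk : T → T ⧸ N.toSubgroup) '' (K₀ : Set T)).ncard := by
      have := hmax K hK
      change f K ≤ m at this
      rw [← hfK₀] at this
      exact this
    exact (Set.eq_of_subset_of_ncard_le hsub hcard (hfin K hK)).symm.subset

/-- **The closure of the union of a nonempty chain of compact subgroups of a tempered group is compact**,
provided the finite subgroups of the discrete quotients `Π/N` have bounded order along a cofinal family of open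
normal subgroups `N` (binder `hbd`).  Proof: the image of the union in such a `Π/N` is the image of ONE member
(`exists_image_subset_of_isChain`), hence finite; the image of the closure is no bigger (discrete target); the
tree's compactness criterion `IsTempered.isCompact_of_finite_image` concludes.
[cite: MochizukiSemiAnbd2006, Def 3.1(i) p.33] -/
theorem IsTempered.isCompact_closure_sUnion_of_isChain (hT : IsTempered T)
    (hbd : ∀ U ∈ 𝓝 (1 : T), ∃ N : OpenNormalSubgroup T, (N : Set T) ⊆ U ∧
      ∃ B : ℕ, ∀ H : Subgroup (T ⧸ N.toSubgroup), (H : Set (T ⧸ N.toSubgroup)).Finite → Nat.card H ≤ B)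
    {c : Set (Subgroup T)} (hc : IsChain (· ≤ ·) c) (hne : c.Nonempty)
    (hcpt : ∀ K ∈ c, IsCompact (K : Set T)) :
    IsCompact (closure (⋃ K ∈ c, (K : Set T))) := by
  refine hT.isCompact_of_finite_image isClosed_closure fun U hU => ?_
  obtain ⟨N, hNU, B, hB⟩ := hbd U hU
  refine ⟨N, hNU, ?_⟩
  haveI : DiscreteTopology (T ⧸ N.toSubgroup) := QuotientGroup.discreteTopology N.isOpen
  obtain ⟨K₀, hK₀, hsub⟩ := IsTempered.exists_image_subset_of_isChain N hB hc hne hcpt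
  have hfin₀ : ((QuotientGroup.mk : T → T ⧸ N.toSubgroup) '' (K₀ : Set T)).Finite :=
    IsTempered.image_mk_finite_of_isCompact N (hcpt K₀ hK₀)
  -- image of the closure ⊆ closure of the image = image (discrete) ⊆ image of `K₀`
  refine hfin₀.subset ?_
  refine (image_closure_subset_closure_image (QuotientGroup.continuous_mk (N := N.toSubgroup))).trans ?_
  rw [(isClosed_discrete _).closure_eq, Set.image_iUnion₂]
  exact Set.iUnion₂_subset fun K hK => hsub K hK

/-! ### Zorn: maximal compact subgroups exist above any compact subgroup -/

/-- **Every compact subgroup of a tempered group lies in a maximal compact subgroup**, provided the finite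
subgroups of the discrete quotients `Π/N` have bounded order along a cofinal family of open normal `N`
(binder `hbd`).  Zorn's lemma on the compact subgroups containing `C`; chains are bounded by the closure of
their union (`isCompact_closure_sUnion_of_isChain`).  At a finite semi-graph of anabelioids this is
[SemiAnbd] Thm 3.7 (iii)+(iv) (`exists_isMaximalCompactSubgroup_ge_of_isCompact_of_finiteGraph`); the present
statement needs no graph. [cite: MochizukiSemiAnbd2006, Thm 3.7(iv) p.41] -/
theorem IsTempered.exists_isMaximalCompactSubgroup_ge (hT : IsTempered T)
    (hbd : ∀ U ∈ 𝓝 (1 : T), ∃ N : OpenNormalSubgroup T, (N : Set T) ⊆ U ∧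
      ∃ B : ℕ, ∀ H : Subgroup (T ⧸ N.toSubgroup), (H : Set (T ⧸ N.toSubgroup)).Finite → Nat.card H ≤ B)
    (C : Subgroup T) (hC : IsCompact (C : Set T)) :
    ∃ K : Subgroup T, IsMaximalCompactSubgroup K ∧ C ≤ K := by
  -- Zorn on `S = {K | C ≤ K ∧ K compact}`
  let S : Set (Subgroup T) := {K | C ≤ K ∧ IsCompact (K : Set T)}
  have hCS : C ∈ S := ⟨le_rfl, hC⟩
  have hchain : ∀ c ⊆ S, IsChain (· ≤ ·) c → ∀ y ∈ c, ∃ ub ∈ S, ∀ z ∈ c, z ≤ ub := by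
    intro c hcS hc y hy
    have hne : c.Nonempty := ⟨y, hy⟩
    haveI : Nonempty c := hne.to_subtype
    have hcpt : ∀ K ∈ c, IsCompact (K : Set T) := fun K hK => (hcS hK).2
    -- upper bound: the topological closure of the supremum (= union, the chain being directed)
    let U : Subgroup T := ⨆ K : c, (K : Subgroup T)
    have hdir : Directed (· ≤ ·) (fun K : c => (K : Subgroup T)) := hc.directedOn.directed_val
    have hUcoe : (U : Set T) = ⋃ K ∈ c, (K : Set T) := by
      rw [Subgroup.coe_iSup_of_directed hdir, ← Set.biUnion_eq_iUnion (s := c) (t := fun K _ => (K : Set T))]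
    have hleU : ∀ K ∈ c, K ≤ U := fun K hK => le_iSup (fun K : c => (K : Subgroup T)) ⟨K, hK⟩
    refine ⟨U.topologicalClosure, ⟨?_, ?_⟩, fun z hz => (hleU z hz).trans (Subgroup.le_topologicalClosure U)⟩
    · exact ((hcS hy).1.trans (hleU y hy)).trans (Subgroup.le_topologicalClosure U)
    · have h := hT.isCompact_closure_sUnion_of_isChain hbd hc hne hcpt
      rw [← hUcoe] at h
      exact h
  obtain ⟨K, hCK, hKmax⟩ := zorn_le_nonempty₀ S hchain C hCS
  refine ⟨K, ⟨hKmax.1.2, fun K' hK' hKK' => ?_⟩, hCK⟩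
  exact le_antisymm (hKmax.2 ⟨hCK.trans hKK', hK'⟩ hKK') hKK'

/-- **Maximal compact subgroups exist** in a tempered group whose discrete quotients have bounded finite
subgroups along a cofinal family (take `C = ⊥`). [cite: MochizukiSemiAnbd2006, Thm 3.7(iv) p.41] -/
theorem IsTempered.exists_isMaximalCompactSubgroup (hT : IsTempered T)
    (hbd : ∀ U ∈ 𝓝 (1 : T), ∃ N : OpenNormalSubgroup T, (N : Set T) ⊆ U ∧
      ∃ B : ℕ, ∀ H : Subgroup (T ⧸ N.toSubgroup), (H : Set (T ⧸ N.toSubgroup)).Finite → Nat.card H ≤ B) :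
    ∃ K : Subgroup T, IsMaximalCompactSubgroup K := by
  obtain ⟨K, hK, -⟩ := hT.exists_isMaximalCompactSubgroup_ge hbd ⊥
    (by rw [Subgroup.coe_bot]; exact isCompact_singleton)
  exact ⟨K, hK⟩

end Literature.AnabelianGeometry.SemiGraphs
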